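import Summits.Ventures.HodgeRepro2.BallQuotientMeasure
import Summits.Ventures.HodgeRepro2.PeterssonSlash

/-!
# Bergman integrals as Lebesgue integrals; weight 3 is the plain `L²` product

Kernel support for the blind cell pub-hodge-repro2 (seat p2), T5-ID §ID-4(b′).  Two bookkeeping
identities and their consequence:

* `∫ g dμ_B = ∫_{𝔹²} (1 − ‖z‖²)^{-3} g(z) dz` (the Bergman measure is Lebesgue measure with density);
* for `D ⊆ 𝔹²` measurable and `F` a function on `ℂ²`: `∫_D F dμ_B = ∫_{D} (1 − ‖z‖²)^{-3} F(z) dz`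
  (Lebesgue integral over the same set, viewed in `ℂ²`);
* **weight 3**: `∫_D f \overline{g} (1 − ‖z‖²)^3 dμ_B = ∫_D f \overline{g} dz` — against the invariant
  measure, the Petersson product of two weight-3 forms is the plain `L²` product of the coefficient
  functions with respect to Lebesgue measure on a fundamental domain, i.e. (up to the exterior-algebra
  constant, not formalised) the Hodge pairing `∫_S ω_f ∧ \overline{ω_g}` of the (2,0)-forms
  `ω_f = f dz₁ ∧ dz₂`, `ω_g = g dz₁ ∧ dz₂`.
-/

namespace Summit.Ventures.HodgeRepro2.ShimuraData

open MeasureTheory Complex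

variable {F : Type*} [NormedAddCommGroup F] [NormedSpace ℝ F]

/-- The Bergman measure restricted to a measurable `s ⊆ 𝔹²` is Lebesgue measure with density. -/
theorem setIntegral_bergmanMeasure {s : Set (Fin 2 → ℂ)} (hs : MeasurableSet s) (hsub : s ⊆ ball₂)
    (g : (Fin 2 → ℂ) → F) :
    ∫ x in s, g x ∂bergmanMeasure = ∫ x in s, volumeDensity x • g x := by
  unfold bergmanMeasure
  rw [setIntegral_withDensity_eq_setIntegral_toReal_smul measurable_volumeDensity.ennreal_ofReal
    (Filter.Eventually.of_forall fun _ => ENNReal.ofReal_lt_top) g hs,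
    Measure.restrict_restrict hs, Set.inter_eq_left.mpr hsub]
  refine setIntegral_congr_fun hs fun x hx => ?_
  have h1 : 0 < 1 - normSq₂ x := sub_pos.mpr (normSq₂_lt_one (hsub hx))
  have h2 : 0 ≤ volumeDensity x := by
    unfold volumeDensity
    positivity
  simp only [ENNReal.toReal_ofReal h2]

/-- The Bergman measure lives on the ball: restricting it to `𝔹²` changes nothing. -/
theorem bergmanMeasure_restrict_ball₂ : bergmanMeasure.restrict ball₂ = bergmanMeasure := by
  unfold bergmanMeasure
  rw [restrict_withDensity measurableSet_ball₂, Measure.restrict_restrict measurableSet_ball₂,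
    Set.inter_self]

/-- An integral over `D ⊆ 𝔹²` (subtype) against `bergmanBall` of a function factoring through the
inclusion is the Lebesgue integral over `val '' D` with the Bergman density. -/
theorem setIntegral_bergmanBall {D : Set ball₂} (hD : MeasurableSet D) (g : (Fin 2 → ℂ) → F) :
    ∫ z in D, g (z : Fin 2 → ℂ) ∂bergmanBall =
      ∫ x in Subtype.val '' D, volumeDensity x • g x := by
  have hDm : MeasurableSet (Subtype.val '' D) :=
    (MeasurableEmbedding.subtype_coe measurableSet_ball₂).measurableSet_image.mpr hD
  have hsub : Subtype.val '' D ⊆ ball₂ := by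
    rintro _ ⟨z, -, rfl⟩
    exact z.property
  rw [← setIntegral_bergmanMeasure hDm hsub g, ← integral_indicator hDm, ← integral_indicator hD]
  unfold bergmanBall
  conv_rhs => rw [← bergmanMeasure_restrict_ball₂]
  rw [← integral_subtype_comap measurableSet_ball₂ ((Subtype.val '' D).indicator g)]
  congr 1
  funext z
  by_cases hz : z ∈ D
  · have hz' : (z : Fin 2 → ℂ) ∈ Subtype.val '' D := ⟨z, hz, rfl⟩
    rw [Set.indicator_of_mem hz, Set.indicator_of_mem hz']
  · have hz' : (z : Fin 2 → ℂ) ∉ Subtype.val '' D := by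
      rintro ⟨w, hw, hwz⟩
      exact hz (Subtype.ext hwz ▸ hw)
    rw [Set.indicator_of_notMem hz, Set.indicator_of_notMem hz']

/-- **Weight 3 against the invariant measure is the plain `L²` product**:
`∫_D f \overline{g} (1 − ‖z‖²)^3 dμ_B = ∫_{D} f(z) \overline{g(z)} dz` (Lebesgue measure on `val '' D`). -/
theorem setIntegral_peterssonPair_three (f g : (Fin 2 → ℂ) → ℂ) {D : Set ball₂} (hD : MeasurableSet D) :
    ∫ z in D, peterssonPair 3 f g (z : Fin 2 → ℂ) ∂bergmanBall =
      ∫ x in Subtype.val '' D, f x * (starRingEnd ℂ) (g x) := by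
  rw [setIntegral_bergmanBall hD]
  have hDm : MeasurableSet (Subtype.val '' D) :=
    (MeasurableEmbedding.subtype_coe measurableSet_ball₂).measurableSet_image.mpr hD
  refine setIntegral_congr_fun hDm fun x hx => ?_
  obtain ⟨z, -, rfl⟩ := hx
  rw [Complex.real_smul, mul_comm]
  exact peterssonPair_three_mul_volumeDensity f g z.property

/-- The weight-3 Petersson norm is the `L²`-norm of the coefficient: `∫_D |f|² (1 − ‖z‖²)^3 dμ_B = ∫_D |f|² dz`. -/
theorem setIntegral_petersson_three (f : (Fin 2 → ℂ) → ℂ) {D : Set ball₂} (hD : MeasurableSet D) :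
    ∫ z in D, petersson 3 f (z : Fin 2 → ℂ) ∂bergmanBall = ∫ x in Subtype.val '' D, ‖f x‖ ^ 2 := by
  rw [setIntegral_bergmanBall hD]
  have hDm : MeasurableSet (Subtype.val '' D) :=
    (MeasurableEmbedding.subtype_coe measurableSet_ball₂).measurableSet_image.mpr hD
  refine setIntegral_congr_fun hDm fun x hx => ?_
  obtain ⟨z, -, rfl⟩ := hx
  rw [smul_eq_mul, mul_comm]
  exact petersson_three_mul_volumeDensity f z.property

end Summit.Ventures.HodgeRepro2.ShimuraData
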